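import Summits.PneNP.PneNP.Theorems.ExpanderLinearGeneratorsNoPolyBoundedProofSystemLadder
import Literature.Computability.Complexity.CircuitClasses

/-!
# Crux `ProofcplxThesis` (stmt-PneNP-0097) — kernel-checked companion of STRATEGY-CENSUS.md, pass p1

`X := ¬ HasPolyBoundedProofSystem TAUT` (= `NP ≠ coNP`, `noPolyBoundedProofSystem_iff_NP_ne_coNP`).
This file does NOT attack `X`. It checks, sorry-free, the LOGICAL SHAPES used by the wall-breaker
census (`Cruxes/ProofcplxThesis/STRATEGY-CENSUS.md`, pass p1, §B) to classify every candidate line /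
decomposition of `X`:

* §1 the two recorded DEATHS as lemmas: the identity death `(H → Q) ↔ X` for collapse-fed `H`
  (line `Sketch`, p136832, generalised), and the "theorem-half dichotomy" death (census p0 §D4,
  generalised): if the easy half of a property dichotomy is a theorem, the other half IS `X`;
* §2 the BRIDGE NORMAL FORM: every two-piece decomposition `S₁ ∧ S₂ → X` has `S₂ → (¬X → ¬S₁)`,
  and for a consequence `T` of `X` the split `X ↔ T ∧ (¬X → ¬T)` is exact — so every decomposition of
  `X` is "a statement `T`" + "a conditional-collapse theorem `TAUT ∈ NP → ¬T`";
* §3 the three bridge families of the census instantiated: concentration onto ANY concrete proof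
  system `Q` (`X ↔ ¬PB(Q) ∧ (HasPBPS TAUT → PB(Q))`, generalising the Frege split of p0 §D1), the
  Karp–Lipton bridge (`NP ⊄ P/poly` + `¬X → NP ⊆ P/poly`), and the separator-class family
  (`NP ⊄ Cl` + `NP ∩ coNP ⊆ Cl`, e.g. Edmonds' "good characterisation ⇒ P" with `P ≠ NP`), together with
  the identity showing why no separator class is believed to work on both sides:
  `X ↔ ¬ (NP ⊆ NP ∩ coNP)`.

Sources: S. A. Cook, R. A. Reckhow, JSL 44 (1979) §1; R. Karp, R. Lipton, STOC 1980; J. Edmonds,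
J. Res. NBS 71B (1967) §1 ("good algorithm" / "good characterization"); J. Krajíček, *Proof complexity* (CUP 2019)
§21.1. Planner planner-cstrat-stmt-PneNP-0097-p1-0 (crux-strategist, gen 1 / pass p1), 2026-08-17.
-/

set_option linter.dupNamespace false

namespace Summit.PneNP.PneNP.Cruxes.ProofcplxThesis.P1

open Literature.Computability.Complexity Literature.Computability.MetaComplexity
open Summit.PneNP.PneNP.Theses Summit.PneNP.PneNP.Theorems

/-- The crux, by its route name (definitionally route ProofCplx's `ProofcplxThesis`). -/
abbrev X : Prop := ExpanderLinearGenerators.NoPolyBoundedProofSystem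

theorem X_iff_proofcplxThesis : X ↔ ProofCplx.ProofcplxThesis := Iff.rfl

/-! ## §1 The two recorded deaths, as lemmas -/

/-- **Identity death (generalised from line `Sketch`, p136832).** If the hypothesis `H` of a stub
`H → Q` is paid for by the collapse (`¬X → H`) and its conclusion gives `X` (`Q → X`), the stub
already proves `X`; if moreover `X → Q`, the stub is literally equivalent to `X`. [folklore] -/
theorem collapseFed_stub_implies_X {H Q : Prop} (hH : ¬ X → H) (hQ : Q → X) (hstub : H → Q) : X := by
  by_contra hX
  exact hX (hQ (hstub (hH hX)))

/-- The `↔` form of the identity death. [folklore] -/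
theorem collapseFed_stub_iff_X {H Q : Prop} (hH : ¬ X → H) (hQ : Q → X) (hXQ : X → Q) :
    (H → Q) ↔ X :=
  ⟨collapseFed_stub_implies_X hH hQ, fun hX _ => hXQ hX⟩

/-- **Theorem-half dichotomy death (generalised census p0 §D4).** Let `Pr` be any property of
verifiers such that "no polynomially bounded proof system for `TAUT` has `Pr`" is a THEOREM
(feasible interpolation under cryptographic hypotheses, automatability under `P ≠ NP`, …). Then the
remaining half of the dichotomy, "no proof system WITHOUT `Pr` is polynomially bounded", is
equivalent to `X` itself — registering it as a stub is costume. [folklore] -/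
theorem dichotomy_other_half_iff_X (Pr : (List Bool → List Bool → Bool) → Prop)
    (hthm : ∀ V, IsProofSystemFor V TAUT → IsPolyBounded V → ¬ Pr V) :
    (∀ V, IsProofSystemFor V TAUT → ¬ Pr V → ¬ IsPolyBounded V) ↔ X := by
  constructor
  · rintro h ⟨V, hV, hB⟩
    exact h V hV (hthm V hV hB) hB
  · intro hX V hV _ hB
    exact hX ⟨V, hV, hB⟩

/-! ## §2 Bridge normal form of decompositions -/

/-- **Bridge normal form.** In any two-piece decomposition `S₁ ∧ S₂ → X`, the second piece implies
the conditional-collapse statement `¬X → ¬S₁` ("in the counterexample world, `S₁` fails"); i.e. up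
to weakening the second piece IS that bridge. [folklore] -/
theorem bridge_normal_form {S₁ S₂ : Prop} (h : S₁ → S₂ → X) : S₂ → (¬ X → ¬ S₁) :=
  fun h₂ hX h₁ => hX (h h₁ h₂)

/-- For a consequence `T` of `X` the bridge split is exact: `X ↔ T ∧ (¬X → ¬T)`. Every
decomposition of `X` in the census (Frege/EF/ZFC-Frege concentration, Karp–Lipton, Edmonds, …) is
an instance, with `¬X → ¬T` the piece that never has a mechanism. [folklore] -/
theorem X_iff_piece_and_bridge {T : Prop} (hXT : X → T) : X ↔ (T ∧ (¬ X → ¬ T)) := by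
  constructor
  · intro hX
    exact ⟨hXT hX, fun h => absurd hX h⟩
  · rintro ⟨hT, hB⟩
    by_contra hX
    exact hB hX hT

/-! ## §3 The three bridge families, instantiated -/

/-- **β1 — concentration onto a concrete system (generalises p0 §D1 from `textbookFrege` to any
proof system `Q`).** `X ↔ (Q is not p-bounded) ∧ (if anything is p-bounded then Q is)`. The second
conjunct is implied by "the collapse witness has `T_Q`-provable soundness" (census p1 §B.D8) and by
"`Q` is optimal"; it has no independent mechanism. [cite: CookReckhow1979, §1 (Prop. 1.1)] -/
theorem X_iff_lowerBound_and_concentration {Q : List Bool → List Bool → Bool}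
    (hQ : IsProofSystemFor Q TAUT) :
    X ↔ (¬ IsPolyBounded Q) ∧ (HasPolyBoundedProofSystem TAUT → IsPolyBounded Q) := by
  constructor
  · intro hX
    exact ⟨fun hB => hX ⟨Q, hQ, hB⟩, fun h => absurd h hX⟩
  · rintro ⟨hlb, hconc⟩ hPB
    exact hlb (hconc hPB)

/-- Given the lower bound for `Q`, concentration onto `Q` is literally `X` (why β1 is no leverage
unless the concentration piece has its own mechanism). [cite: CookReckhow1979, §1 (Prop. 1.1)] -/
theorem concentration_iff_X_of_lowerBound {Q : List Bool → List Bool → Bool}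
    (hlb : ¬ IsPolyBounded Q) :
    (HasPolyBoundedProofSystem TAUT → IsPolyBounded Q) ↔ X :=
  ⟨fun hconc hPB => hlb (hconc hPB), fun hX h => absurd h hX⟩

/-- **β2 — the Karp–Lipton bridge** (= the feasible-interpolation dichotomy of p0 §D4 unfolded, and
the cryptographic split `NP ∩ coNP ⊄ P/poly`, census p1 §B.D8): circuit lower bounds for `NP` give `X`
exactly when the counterexample world forces `NP ⊆ P/poly` — a conditional collapse nobody can
support (Kannan's theorem inside `¬X` points the other way: `NP ⊄ SIZE(n^k)` for every `k`,
`StrategySplit.NP_not_fixedPolySize_of_not_X`). [cite: KarpLipton1980, §1] -/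
theorem X_of_npNotPPoly_and_bridge (h₁ : ¬ (Nondeterministic.NP ⊆ PPoly))
    (h₂ : ¬ X → Nondeterministic.NP ⊆ PPoly) : X := by
  by_contra hX
  exact h₁ (h₂ hX)

/-- **β3 — separator-class splits.** For ANY class `Cl` of languages: `NP ⊄ Cl` and
`NP ∩ coNP ⊆ Cl` together give `X` (inside `¬X`, `NP = coNP = NP ∩ coNP ⊆ Cl`). With `Cl = P` this
is Edmonds' thesis "good characterisation ⇒ good algorithm" plus `P ≠ NP`; with `Cl = BQP`,
`SUBEXP`, … the second piece is disbelieved (lattice problems in `NP ∩ coNP`), with `Cl ⊇ coNP`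
(`coAM`, `AM ∩ coAM`) the second piece is a theorem and the first is `≥ X` (§1 death).
[cite: Edmonds1967, §1] -/
theorem X_of_separatorClass (Cl : Set (Language Bool))
    (h₁ : ¬ (Nondeterministic.NP ⊆ Cl)) (h₂ : Nondeterministic.NP ∩ coNP ⊆ Cl) : X := by
  by_contra hX
  have hNC : Nondeterministic.NP = coNP := by
    by_contra hne
    exact hX (noPolyBoundedProofSystem_of_NP_ne_coNP hne)
  apply h₁
  intro L hL
  refine h₂ ⟨hL, ?_⟩
  rw [← hNC]
  exact hL

/-- The Edmonds instance: `P ≠ NP` (in the form "some `NP` language is not in `P`") together with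
`NP ∩ coNP ⊆ P` gives `X`. Both pieces are natural and unconditional; the second is disbelieved
under standard cryptography and the first is the summit — recorded, not proposed.
[cite: Edmonds1967, §1] -/
theorem X_of_P_ne_NP_and_goodCharacterisation
    (h₁ : ∃ L ∈ Nondeterministic.NP, L ∉ Classes.P)
    (h₂ : Nondeterministic.NP ∩ coNP ⊆ Classes.P) : X :=
  X_of_separatorClass Classes.P
    (fun h => by
      obtain ⟨L, hL, hLP⟩ := h₁
      exact hLP (h hL))
    h₂

/-- Why no separator class is believed to work on BOTH sides: the two separator hypotheses
jointly assert `NP ⊄ NP ∩ coNP`, which is `X` verbatim. So believing both pieces for some `Cl` is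
believing `X` with a named separator — the community's belief in `NP ≠ coNP` is not factored through
any such `Cl` (census p1 §B.D9). [cite: CookReckhow1979, §1 (Prop. 1.1)] -/
theorem X_iff_NP_not_subset_inter :
    X ↔ ¬ (Nondeterministic.NP ⊆ Nondeterministic.NP ∩ coNP) := by
  constructor
  · intro hX hsub
    have hsub' : Nondeterministic.NP ⊆ coNP := fun L hL => (hsub hL).2
    exact (noPolyBoundedProofSystem_iff_NP_ne_coNP.1 hX) (NP_eq_coNP_of_NP_subset_coNP hsub')
  · intro h
    by_contra hX
    have hNC : Nondeterministic.NP = coNP := by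
      by_contra hne
      exact hX (noPolyBoundedProofSystem_of_NP_ne_coNP hne)
    exact h (fun L hL => ⟨hL, by rw [← hNC]; exact hL⟩)

end Summit.PneNP.PneNP.Cruxes.ProofcplxThesis.P1
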